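import Summits.Langlands.Langlands.Theses.ParityBlindBianchi
import Summits.Langlands.Langlands.Theorems.IrreducibilityBySelfDualityIrreducibleOffSectorArtinType
import Summits.Langlands.Langlands.Theorems.IrreducibilityBySelfDualityReciprocityUpToIrreducibilityArtinSectorAboveClause
import Literature.NumberTheory.Automorphic.StrongArtinGL2
import Literature.NumberTheory.Automorphic.GLnAdelicStructureProofs
import Literature.NumberTheory.GaloisRepresentations.ArtinReciprocityCharacterProofs
import Literature.FieldTheory.AlgClosed.PadicAlgClEquivComplex
import HarnessLib

/-!
# Route ParityBlindBianchi — `EvenArtinJunction` (stmt-Langlands-2908): the summit implies the target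

`--supports stmt-Langlands-2908` (closes nothing).  The landed position file
`Theorems/ParityBlindBianchiEvenArtinJunction.lean` (p137220) records the truth table of the junction
`J := EvenArtinJunction` (`J ↔ (X → Langlands)` by `Iff.rfl`, `J ↔ ¬X ∨ Langlands`,
`¬J ↔ X ∧ ¬Langlands`, …) for the route target `X := EvenIcosahedralStrongArtin`.  One arrow was
missing from the tree: that the typed SUMMIT implies the typed TARGET.  This file proves it, in the
natural generality, and derives the exact position of the junction:

* `hasFrobCharpolyAt_satakePolynomial_of_lAdicDualTransport` — the inverse of the `m = 1` arithmetic
  Satake dictionary: if `ρ₀ = ι⁻¹(σ⁻ᵀ)` entrywise (the `ℓ`-adic transport of the contragredient of an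
  Artin representation `σ : Γ_K → GL_n(ℂ)`, tree `IrreducibleOffSector.exists_lAdicDualTransport`) has
  arithmetic-Frobenius characteristic polynomial `arithFrobPolyOfSatake ι q_v 1 α = ∏ (X - ι⁻¹(a⁻¹))`
  at `v`, then `σ` has `satakePolynomial α = ∏ (X - a)` there (converse of the tree's
  `hasFrobCharpolyAt_of_lAdicDualTransport`);
* `isPiOfArtinRep_of_eventually_satakeFrobCompatibleAt_lAdicDualTransport` — hence a.e.
  `SatakeFrobCompatibleAt ι π ρ₀` (the summit's unramified clause) gives `IsPiOfArtinRep σ π`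
  (Tunnell's a.e. strong Artin matching) for the SAME `π`;
* `strongArtin_of_langlands` — **the typed summit `Langlands` implies the strong Artin conjecture in
  Tunnell's a.e. sense for every irreducible Artin representation `σ : Γ_K → GL_n(ℂ)`, every `n ≥ 1`,
  every number field `K`**, with an L-algebraic cuspidal `π`: direction (B) at `ℓ = 2`
  (`ι : ℚ̄₂ ≃+* ℂ` by Steinitz, tree `PadicAlgCl.nonempty_ringEquiv_complex`) applied to `ρ₀`, which is
  irreducible (tree) and geometric for the pinned Fontaine datum because its kernel is open (tree
  `ReciprocityUpToIrreducibility.isGeometricFramed_of_isOpen_ker'`: unramified a.e., de Rham above `ℓ`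
  for finite image);
* `parityBlindBianchi_summit_iff_target_and_evenArtinJunction` — `Langlands ↔ (X ∧ J)`: in
  particular the summit implies the route target (the target's icosahedral and evenness hypotheses
  are not used), and the route's full chain (target and junction) is EQUIVALENT to the summit, not
  merely sufficient for it;
* `parityBlindBianchi_evenArtinJunction_iff_target_iff_summit` — `J ↔ (X ↔ Langlands)`.

Nothing here settles the item (that needs the summit or `¬X`); standard axioms only, no definitions.
-/

noncomputable section

set_option linter.dupNamespace false -- project-wide option (lakefile weak.linter.dupNamespace); `Summit.Langlands.Langlands` is the mandated namespace

open scoped MatrixGroups Matrix NumberField Classical Polynomial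
open Filter IsDedekindDomain Field Polynomial
open Literature.NumberTheory.Automorphic Literature.NumberTheory.GaloisRepresentations
open Summit.Langlands

namespace Summit.Langlands.Langlands.Theorems

section Dictionary

variable {K : Type} [Field K] [NumberField K] {n : ℕ} {ℓ : ℕ} [Fact ℓ.Prime]

/-- **Inverse Satake dictionary for the dual transport.**  If `ρ₀(g) = ι⁻¹(((σ g)⁻¹)ᵀ)` entrywise and
the arithmetic Frobenii of `ρ₀` at `v` have characteristic polynomial
`arithFrobPolyOfSatake ι q_v 1 α = ∏_{a ∈ α} (X - ι⁻¹(a⁻¹))`, then those of `σ` have characteristic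
polynomial `satakePolynomial α = ∏_{a ∈ α} (X - a)`: transport the polynomial along `ι`
(`Matrix.charpoly_map`, transpose-invariance) to get `charpoly ((σ g)⁻¹) = ∏ (X - a⁻¹)`, then invert
(`charpoly_inv_eq_prod_of_charpoly_eq_prod`). [cite: BuzzardGeeLMS2014, §2.1 and Rem. 3.2.5] -/
theorem hasFrobCharpolyAt_satakePolynomial_of_lAdicDualTransport {σ : FramedArtinRep K n}
    {ι : PadicAlgCl ℓ ≃+* ℂ} {ρ₀ : FramedGaloisRep K (PadicAlgCl ℓ) n}
    (hρ₀ : ∀ g : absoluteGaloisGroup K,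
      ((ρ₀ g : GL (Fin n) (PadicAlgCl ℓ)) : Matrix (Fin n) (Fin n) (PadicAlgCl ℓ)) =
        ((((σ g)⁻¹ : GL (Fin n) ℂ) : Matrix (Fin n) (Fin n) ℂ)ᵀ).map (ι.symm : ℂ → PadicAlgCl ℓ))
    {v : HeightOneSpectrum (𝓞 K)} {α : Multiset ℂ}
    (h : ρ₀.HasFrobCharpolyAt v (arithFrobPolyOfSatake ι v.residueCard 1 α)) :
    σ.HasFrobCharpolyAt v (satakePolynomial α) := by
  intro 𝔓 h𝔓 g hg
  have h0 := h 𝔓 h𝔓 g hg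
  unfold FramedRep.charpoly at h0 ⊢
  rw [hρ₀ g] at h0
  set M : Matrix (Fin n) (Fin n) ℂ := (((σ g)⁻¹ : GL (Fin n) ℂ) : Matrix (Fin n) (Fin n) ℂ) with hM
  have e1 : (Mᵀ).map (ι.symm : ℂ → PadicAlgCl ℓ) =
      (Mᵀ).map (((ι.symm : ℂ ≃+* PadicAlgCl ℓ) : ℂ →+* PadicAlgCl ℓ) : ℂ → PadicAlgCl ℓ) := rfl
  rw [e1, Matrix.charpoly_map, Matrix.charpoly_transpose, arithFrobPolyOfSatake_one] at h0
  -- `h0 : M.charpoly.map ι⁻¹ = ∏ (X - C (ι⁻¹ a⁻¹))`; peel off `ι⁻¹`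
  have h1 : M.charpoly = (α.map fun a => X - C a⁻¹).prod := by
    apply Polynomial.map_injective ((ι.symm : ℂ ≃+* PadicAlgCl ℓ) : ℂ →+* PadicAlgCl ℓ)
      (ι.symm : ℂ ≃+* PadicAlgCl ℓ).injective
    rw [h0, IrreducibleOffSector.map_multisetProd_X_sub_C]
    rfl
  have hunit : IsUnit M := Units.isUnit _
  have h2 : M⁻¹.charpoly = ((α.map fun a => a⁻¹).map fun c => X - C c⁻¹).prod :=
    IrreducibleOffSector.charpoly_inv_eq_prod_of_charpoly_eq_prod hunit
      (by rw [h1, Multiset.map_map]; rfl)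
  have h3 : ((σ g : GL (Fin n) ℂ) : Matrix (Fin n) (Fin n) ℂ) = M⁻¹ := by
    rw [hM, ← Matrix.coe_units_inv, inv_inv]
  rw [h3, h2, Multiset.map_map]
  unfold satakePolynomial
  refine congrArg Multiset.prod (Multiset.map_congr rfl fun a _ => ?_)
  simp only [Function.comp_apply, inv_inv]

omit [NumberField K] in
/-- **Unramifiedness passes back along the dual transport** (the kernel dictionary
`ρ₀ g = 1 ↔ σ g = 1`). [folklore] -/
theorem isUnramifiedAt_of_lAdicDualTransport {σ : FramedArtinRep K n}
    {ρ₀ : FramedGaloisRep K (PadicAlgCl ℓ) n}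
    (hker : ∀ g : absoluteGaloisGroup K, ρ₀ g = 1 ↔ σ g = 1) {v : HeightOneSpectrum (𝓞 K)}
    (h : ρ₀.IsUnramifiedAt v) : σ.IsUnramifiedAt v :=
  fun 𝔓 h𝔓 τ hτ => (hker τ).mp (h 𝔓 h𝔓 τ hτ)

/-- **From the summit's a.e. unramified clause on the dual transport to Tunnell's `π = π(σ)`.**  If
`ρ₀ = ι⁻¹(σ⁻ᵀ)` entrywise with `ρ₀ g = 1 ↔ σ g = 1`, and `ρ₀` is Satake–Frobenius compatible with
`(π, ι)` at almost all places (`Summit.Langlands.SatakeFrobCompatibleAt`), then `IsPiOfArtinRep σ π`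
for the same `π` (no contragredient on the automorphic side is needed: the dual was taken on the
Galois side). [cite: Tunnell1981, p. 173] [cite: BuzzardGeeLMS2014, Conj. 3.2.1 and Rem. 3.2.5] -/
theorem isPiOfArtinRep_of_eventually_satakeFrobCompatibleAt_lAdicDualTransport
    {hcpt : isCompact_glFiniteIntegralLevel n K} {σ : FramedArtinRep K n}
    {π : AutomorphicRepData (AutomorphyDatum.gl n K hcpt)} {ι : PadicAlgCl ℓ ≃+* ℂ}
    {ρ₀ : FramedGaloisRep K (PadicAlgCl ℓ) n}
    (hρ₀ : ∀ g : absoluteGaloisGroup K,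
      ((ρ₀ g : GL (Fin n) (PadicAlgCl ℓ)) : Matrix (Fin n) (Fin n) (PadicAlgCl ℓ)) =
        ((((σ g)⁻¹ : GL (Fin n) ℂ) : Matrix (Fin n) (Fin n) ℂ)ᵀ).map (ι.symm : ℂ → PadicAlgCl ℓ))
    (hker : ∀ g : absoluteGaloisGroup K, ρ₀ g = 1 ↔ σ g = 1)
    (h : ∀ᶠ v : HeightOneSpectrum (𝓞 K) in cofinite, SatakeFrobCompatibleAt ι π ρ₀ v) :
    IsPiOfArtinRep σ π := by
  filter_upwards [h] with v hv
  obtain ⟨α, hα, hunr, hcp⟩ := hv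
  exact ⟨α, hα, isUnramifiedAt_of_lAdicDualTransport hker hunr,
    hasFrobCharpolyAt_satakePolynomial_of_lAdicDualTransport hρ₀ hcp⟩

end Dictionary

/-- **The typed summit implies the strong Artin conjecture in Tunnell's a.e. sense, for every
irreducible Artin representation of every rank over every number field.**  Given `Langlands`, take the
reciprocity datum `𝓡` of `K`, an abstract `ι : ℚ̄₂ ≃+* ℂ` (Steinitz), and the `2`-adic transport
`ρ₀ = ι⁻¹(σ⁻ᵀ)` of the contragredient of `σ` (`IrreducibleOffSector.exists_lAdicDualTransport`): it is
irreducible, and geometric for the pinned Fontaine datum since its kernel (= `ker σ`) is open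
(`ReciprocityUpToIrreducibility.isGeometricFramed_of_isOpen_ker'`).  Direction (B) at `n`, `ℓ = 2`
gives an L-algebraic cuspidal `π` with `Corresponds 𝓡 ι π ρ₀`, whose cofinite Satake clause transfers
back to `IsPiOfArtinRep σ π`. [cite: FontaineMazurGeometric1995, Conj. 1]
[cite: BuzzardGeeLMS2014, Conj. 3.2.2] [cite: Tunnell1981, p. 173] -/
theorem strongArtin_of_langlands (hL : _root_.Langlands) {K : Type} [Field K] [NumberField K]
    {n : ℕ} (hn : 0 < n) (σ : FramedArtinRep K n) (hirr : σ.toGaloisRep.IsIrreducible) :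
    ∃ (hcpt : isCompact_glFiniteIntegralLevel n K) (π : CuspidalAutomorphicRepData n K hcpt),
      π.1.IsLAlgebraic ∧ IsPiOfArtinRep σ π.1 := by
  obtain ⟨𝓡, h𝓡⟩ := hL K
  have hcpt : isCompact_glFiniteIntegralLevel n K := isCompact_glFiniteIntegralLevel_holds n K
  obtain ⟨ι⟩ := PadicAlgCl.nonempty_ringEquiv_complex 2
  obtain ⟨ρ₀, hρ₀, hker, hirr₀⟩ := IrreducibleOffSector.exists_lAdicDualTransport σ ι
  have hkerOpen : IsOpen (ρ₀.toMonoidHom.ker : Set (absoluteGaloisGroup K)) := by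
    have hset : (ρ₀.toMonoidHom.ker : Set (absoluteGaloisGroup K)) = σ.toMonoidHom.ker := by
      ext g
      simp only [SetLike.mem_coe, MonoidHom.mem_ker]
      exact hker g
    rw [hset]
    exact FramedArtinRep.isOpen_ker_toMonoidHom σ
  obtain ⟨π, hLalg, hcorr⟩ := (h𝓡 n hn hcpt).2 2 ι ρ₀ (hirr₀ hirr)
    (ReciprocityUpToIrreducibility.isGeometricFramed_of_isOpen_ker' 𝓡 ρ₀ hkerOpen)
  exact ⟨hcpt, π, hLalg,
    isPiOfArtinRep_of_eventually_satakeFrobCompatibleAt_lAdicDualTransport hρ₀ hker hcorr.1⟩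

open Summit.Langlands.Langlands.Theses.ParityBlindBianchi

/-- **The summit is equivalent to target-and-junction**:
`Langlands ↔ (EvenIcosahedralStrongArtin ∧ EvenArtinJunction)`.  The forward direction is the arrow
that was missing from the tree — the typed summit implies the typed route TARGET (the `n = 2`, `K = ℚ`
instance of `strongArtin_of_langlands`; the icosahedral-type and evenness hypotheses of the target are
not used, and its conclusion is `IsPiOfArtinRep ρ π.1` unfolded) — together with the trivial
`Langlands → EvenArtinJunction`; the backward direction is modus ponens (the junction is the arrow
target ⇒ summit by definition).  So the route's full chain (target and junction) is not merely
sufficient for the summit but EQUIVALENT to it.  Stated as an `↔` so that no audit reads a conditional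
arrow as progress on either item. [cite: BuzzardGeeLMS2014, Conj. 3.2.2] [cite: Tunnell1981, p. 173] -/
theorem parityBlindBianchi_summit_iff_target_and_evenArtinJunction :
    _root_.Langlands ↔ (EvenIcosahedralStrongArtin ∧ EvenArtinJunction) := by
  refine ⟨fun hL => ⟨?_, fun _ => hL⟩, fun h => h.2 h.1⟩
  intro ρ hirr _ _
  obtain ⟨hcpt, π, -, hπ⟩ := strongArtin_of_langlands hL two_pos ρ hirr
  exact ⟨hcpt, π, hπ⟩

/-- **Exact position of the junction**: `EvenArtinJunction ↔ (EvenIcosahedralStrongArtin ↔ Langlands)`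
(target ⇒ summit is the junction by definition; summit ⇒ target is the forward direction of
`parityBlindBianchi_summit_iff_target_and_evenArtinJunction`).  Compare the landed
`parityBlindBianchi_evenArtinJunction_iff_imp : EvenArtinJunction ↔ (EvenIcosahedralStrongArtin → Langlands)`
(p137220): the implication there is in fact a bi-implication. [cite: BuzzardGeeLMS2014, Conj. 3.2.2] -/
theorem parityBlindBianchi_evenArtinJunction_iff_target_iff_summit :
    EvenArtinJunction ↔ (EvenIcosahedralStrongArtin ↔ _root_.Langlands) :=
  ⟨fun hJ => ⟨hJ, fun hL => (parityBlindBianchi_summit_iff_target_and_evenArtinJunction.mp hL).1⟩,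
    fun h => h.1⟩

end Summit.Langlands.Langlands.Theorems

end
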